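import Summits.KontsevichZagierPeriods.KontsevichZagierPeriods.Theorems.HermiteRigidityReductionRigidityGenReduction
import Summits.KontsevichZagierPeriods.KontsevichZagierPeriods.Theorems.HermiteRigidityReductionRigidityLineRigidity
import Literature.NumberTheory.Transcendental.KZVolumeConjectureProofs
import Mathlib.Analysis.SpecialFunctions.Integrals.Basic

/-!
# KontsevichZagierPeriods / HermiteRigidity — crux `ReductionRigidity` (stmt-KontsevichZagierPeriods-3407), line `Sketch`: the PADÉ BOX ISLAND IN EVERY WEIGHT

Route `KontsevichZagierPeriods/HermiteRigidity`, crux stmt-KontsevichZagierPeriods-3407 (`ReductionRigidity` =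
REDUCTION + RIGIDITY, kernel-checked equivalent to the summit). The route's content is the EXPLICIT
(B, reduction) on sectors where transcendence theory supplies rigidity today; this file lands such a sector
in EVERY motivic weight, outside cohomological degree one (idea card `pade-box-islands`, line `Sketch`):

* `padeBoxKernelGen_one_rat ν`, `padeBoxKernelGen_one N` — **UNCONDITIONAL**, every rational level
  `ν > 1` or `ν < 0` (resp. integer `N ≥ 2`): the case `w = 1` (line generators `[□¹, x^a/(ν − x)^m]` and the
  constants; at `ν = −1` the ALTERNATING line sector `[□¹, x^a/(1 + x)^m]`, value `log 2`), its rigidity input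
  `log(ν/(ν−1)) ∉ ℚ` being Baker's theorem in the tree (`baker_holds`, through the landed
  `eq_zero_of_add_mul_log_eq_zero` / `stub_lineRigidity`).
* `padeBoxKernelGen w ν` — for every `w` and every RATIONAL level `ν > 1` or `ν < 0` (integer `N ≥ 2`:
  `stub_padeBoxKernelGen`): IF the `w + 1` numbers `Lᵢ = ∫_□ⁱ dx/(ν − x₀⋯x_{i−1})` (`L₀ = 1/(ν − 1)`,
  `Lᵢ = Li_i(1/ν)`) are linearly independent over `ℚ`,
  THEN Conjecture 1 holds in kernel form on the sector generated by ALL box generators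
  `[□ʲ, x^a/(ν − x₀⋯x_{j−1})^m]`, `j ≤ w`, `a : Fin j → ℕ`, `m ∈ ℕ` (monomials and rational constants
  included): every `ℤ`-combination of value `0` lies in `KZ.relations`. The level `ν = −1` is the sector of
  the ALTERNATING box integrals `∫_□ʲ x^a/(1 + x₀⋯x_{j−1})^m` with normal-form values
  `log 2, ζ(2)/2, …, (1 − 2^{1−w})ζ(w)` (rigidity open there beyond `w = 1`).

The reduction (`genReduction`, companion file) is unconditional with rational coefficients, so only
ℚ-LINEAR independence at the deep-interior point `1/N` is consumed — a theorem of Padé-approximation type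
for `N ≥ N₀(w)` (Nikišin 1979 qualitatively; David–Hirata-Kohno–Kawashima 2020, Thm 2.1 with `m = 1`,
`x = 0`, `K = ℚ`: `log N > w²(1 + log (5/2)) + w log 3`; for `w = 2` Viola–Zudilin 2018 give `N ≥ 9`), never
algebraic independence and never the point `1` — the strength barriers of the catalogue
(`kzConjecture_implies_oddZetaAlgIndep`, …) are respected, and the complement of the islands (the crux
itself) stays summit-strength.

References: M. Kontsevich, D. Zagier, *Periods* (2001), §1.2 [cite: KontsevichZagier2001, §1.2];
E. M. Nikišin, Mat. Sb. 109 (1979) [cite: Nikishin1979]; S. David, N. Hirata-Kohno, M. Kawashima, Moscow J.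
Comb. Number Theory 9 (2020), Thm 2.1 [cite: DavidHirataKohnoKawashima2020, Thm 2.1]; C. Viola, W. Zudilin,
J. reine angew. Math. 736 (2018) [cite: ViolaZudilin2018, main theorem]; M. Hata, J. reine angew. Math. 407
(1990) [cite: Hata1990].
-/

noncomputable section

open MeasureTheory Set MvPolynomial

namespace Summit.KontsevichZagierPeriods.HermiteRigidity.ReductionRigidity

open Literature.NumberTheory.Transcendental
open Literature.NumberTheory.Transcendental.KZ

/-- Value of a normal form in dimension `i`: `eval [□ⁱ, α/(ν − ∏x)] = α · ∫_□ⁱ 1/(ν − ∏x)`. [folklore] -/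
theorem eval_nfRep {i : ℕ} {ν : ℚ} {α : ℚ} {s : IntegralRep i} (hs : s.domain = cube i)
    (hsi : EqOn s.integrand (fun p => (α : ℝ) / ((ν : ℝ) - ∏ l, p l)) (cube i)) :
    KZ.eval (KZ.of s) = (α : ℝ) * ∫ p in cube i, 1 / ((ν : ℝ) - ∏ l, p l) := by
  rw [eval_of, IntegralRep.value, hs, setIntegral_congr_fun measurableSet_cube hsi, ← integral_const_mul]
  refine setIntegral_congr_fun measurableSet_cube fun p _ => ?_
  rw [div_eq_mul_one_div]

/-- **The Padé box island in every weight, at a rational level** `PadeBoxKernelGen w ν`: for an integer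
`w` and a rational `ν` with `ν > 1` or `ν < 0`, IF the `w + 1` numbers `Lᵢ = ∫_□ⁱ dx/(ν − x₀⋯x_{i−1})`
(`i = 0, …, w`; `L₀ = 1/(ν−1)`, `Lᵢ = Li_i(1/ν)`, the alternating values at `ν < 0`) are linearly independent
over `ℚ`, THEN Conjecture 1 holds in kernel form on the sector generated by ALL box generators
`[□ʲ, x^a/(ν − x₀⋯x_{j−1})^m]`, `j ≤ w`, `a : Fin j → ℕ`, `m ∈ ℕ` (monomials and rational constants included
as `m = 0`, `j = 0`): every `ℤ`-combination of value `0` lies in `KZ.relations`. The hypothesis is a theorem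
of Padé type at `ν = N ≥ N₀(w)` (Nikišin 1979; David–Hirata-Kohno–Kawashima 2020, Thm 2.1 with `m = 1`, `x = 0`,
`K = ℚ`). [cite: KontsevichZagier2001, §1.2] [cite: Nikishin1979] [cite: DavidHirataKohnoKawashima2020, Thm 2.1] -/
theorem padeBoxKernelGen (w : ℕ) (ν : ℚ) (hν : 1 < ν ∨ ν < 0)
    (hrig : ∀ β : ℕ → ℚ, (∑ i ∈ Finset.range (w + 1), (β i : ℝ) * ∫ p in cube i, 1 / ((ν : ℝ) - ∏ l, p l)) = 0 →
      ∀ i ∈ Finset.range (w + 1), β i = 0) :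
    ∀ c ∈ AddSubgroup.closure
      {c | ∃ (j : ℕ) (r : IntegralRep j) (a : Fin j → ℕ) (m : ℕ), j ≤ w ∧ r.domain = cube j ∧
          EqOn r.integrand (fun p => (∏ l, p l ^ a l) / ((ν : ℝ) - ∏ l, p l) ^ m) (cube j) ∧ c = KZ.of r},
      KZ.eval c = 0 → c ∈ KZ.relations := by
  intro c hc h0
  have hNFc : ∃ (α : ℕ → ℚ) (s : (i : ℕ) → IntegralRep i),
      (∀ i, (s i).domain = cube i ∧ EqOn (s i).integrand (fun p => (α i : ℝ) / ((ν : ℝ) - ∏ l, p l)) (cube i)) ∧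
      c - ∑ i ∈ Finset.range (w + 1), KZ.of (s i) ∈ KZ.relations := by
    clear h0
    induction hc using AddSubgroup.closure_induction with
    | mem x hx =>
      obtain ⟨j, r, a, m, hjw, hr, hri, rfl⟩ := hx
      exact genReduction hν j hjw m 1 a r hr fun p hp => by rw [hri hp]; push_cast; ring
    | zero => exact gnf_zero hν w
    | add x y _ _ hx hy => exact gnf_add hν hx hy
    | neg x _ hx => exact gnf_neg hν hx
  obtain ⟨α, s, hs, hcn⟩ := hNFc
  have hval : KZ.eval (∑ i ∈ Finset.range (w + 1), KZ.of (s i)) = 0 := by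
    have := eval_eq_zero_of_mem_relations hcn
    rwa [map_sub, h0, zero_sub, neg_eq_zero] at this
  rw [map_sum] at hval
  simp_rw [fun i => eval_nfRep (hs i).1 (hs i).2] at hval
  have hα := hrig α hval
  have hz : ∀ i ∈ Finset.range (w + 1), KZ.of (s i) ∈ KZ.relations := fun i hi =>
    of_mem_relations_of_eqOn_zero (s i) fun p hp => by
      rw [(hs i).1] at hp
      rw [(hs i).2 hp, hα i hi]
      simp
  have : c = (c - ∑ i ∈ Finset.range (w + 1), KZ.of (s i)) + ∑ i ∈ Finset.range (w + 1), KZ.of (s i) := by abel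
  rw [this]
  exact KZ.relations.add_mem hcn (KZ.relations.sum_mem hz)

/-- **Registered form** of `padeBoxKernelGen` at an integer level (crux stub `stub_padeBoxKernelGen`): the
Padé box island in every weight. [cite: KontsevichZagier2001, §1.2] [cite: DavidHirataKohnoKawashima2020, Thm 2.1] -/
theorem stub_padeBoxKernelGen : ∀ (w N : ℕ), 2 ≤ N →
    (∀ β : ℕ → ℚ, (∑ i ∈ Finset.range (w + 1), (β i : ℝ) * ∫ p in cube i, 1 / ((N : ℝ) - ∏ l, p l)) = 0 →
      ∀ i ∈ Finset.range (w + 1), β i = 0) →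
    ∀ c ∈ AddSubgroup.closure
      {c | ∃ (j : ℕ) (r : IntegralRep j) (a : Fin j → ℕ) (m : ℕ), j ≤ w ∧ r.domain = cube j ∧
          EqOn r.integrand (fun p => (∏ l, p l ^ a l) / ((N : ℝ) - ∏ l, p l) ^ m) (cube j) ∧ c = KZ.of r},
      KZ.eval c = 0 → c ∈ KZ.relations := by
  intro w N hN hrig
  have h := padeBoxKernelGen w (N : ℚ) (natLevel hN)
  simp only [Rat.cast_natCast] at h
  exact h hrig

/-- **The weight-one island, UNCONDITIONAL**: for every integer `N ≥ 2`, Conjecture 1 in kernel form on the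
sector of all box generators of dimension `≤ 1`, `[□¹, x^a/(N − x)^m]` and the constants `[pt, 1/(N − 1)^m]`.
The rigidity hypothesis of `padeBoxKernelGen 1 N` — ℚ-independence of `L₀ = 1/(N − 1)` and
`L₁ = ∫_□ dx/(N − x) = log(N/(N−1))` — is Baker's theorem in the tree (`baker_holds`), through the landed
stub `stub_lineRigidity`. [cite: KontsevichZagier2001, §1.2] [cite: Baker1975, Thm 2.1] -/
theorem padeBoxKernelGen_one (N : ℕ) (hN : 2 ≤ N) :
    ∀ c ∈ AddSubgroup.closure
      {c | ∃ (j : ℕ) (r : IntegralRep j) (a : Fin j → ℕ) (m : ℕ), j ≤ 1 ∧ r.domain = cube j ∧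
          EqOn r.integrand (fun p => (∏ l, p l ^ a l) / ((N : ℝ) - ∏ l, p l) ^ m) (cube j) ∧ c = KZ.of r},
      KZ.eval c = 0 → c ∈ KZ.relations := by
  refine stub_padeBoxKernelGen 1 N hN fun β hβ => ?_
  have hN1 : (N : ℝ) - 1 ≠ 0 := by
    have : (2 : ℝ) ≤ N := by exact_mod_cast hN
    linarith
  -- `Σ_{i<2} βᵢ Lᵢ = β₀/(N − 1) + β₁ L₁`
  rw [Finset.sum_range_succ, Finset.sum_range_one] at hβ
  have hL0 : (∫ p in cube 0, 1 / ((N : ℝ) - ∏ l, p l)) = 1 / ((N : ℝ) - 1) := by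
    have hcube : cube 0 = (univ : Set (Fin 0 → ℝ)) := eq_univ_of_forall fun x i => i.elim0
    rw [hcube, setIntegral_univ, Measure.volume_pi_eq_dirac (default : Fin 0 → ℝ), integral_dirac]
    simp
  have hL1 : (∫ p in cube 1, 1 / ((N : ℝ) - ∏ l, p l)) = ∫ p in cube 1, 1 / ((N : ℝ) - p 0) := by
    refine setIntegral_congr_fun measurableSet_cube fun p _ => ?_
    simp
  rw [hL0, hL1] at hβ
  -- multiply by `N − 1` and apply the rigidity of `(1, L₁)`
  have h := stub_lineRigidity N hN (β 0) (β 1 * ((N : ℚ) - 1)) (by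
    have := congrArg (fun t => ((N : ℝ) - 1) * t) hβ
    simp only [mul_zero] at this
    push_cast
    field_simp at this
    linear_combination this)
  have hN1q : ((N : ℚ) - 1) ≠ 0 := by
    have : (2 : ℚ) ≤ N := by exact_mod_cast hN
    linarith
  intro i hi
  have hi' : i = 0 ∨ i = 1 := by
    have := Finset.mem_range.1 hi; omega
  rcases hi' with rfl | rfl
  · exact h.1
  · exact (mul_eq_zero.1 h.2).resolve_right hN1q

/-- **The value of the weight-one normal form at a rational level**: `∫_□ dx/(ν − x) = log (ν/(ν − 1))`
for `ν > 1` or `ν < 0` (substitution `u = ν − x`, then `∫ du/u` over an interval not containing `0`).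
[folklore] -/
theorem integral_cube_one_level {ν : ℚ} (hν : 1 < ν ∨ ν < 0) :
    ∫ p in cube 1, 1 / ((ν : ℝ) - p 0) = Real.log (((ν / (ν - 1) : ℚ)) : ℝ) := by
  rw [setIntegral_cube_one_eq (fun x => 1 / ((ν : ℝ) - x)), integral_Icc_eq_integral_Ioc,
    ← intervalIntegral.integral_of_le zero_le_one]
  have h := intervalIntegral.integral_comp_sub_left (a := 0) (b := 1) (fun x : ℝ => 1 / x) (ν : ℝ)
  simp only [sub_zero] at h
  rw [h]
  push_cast
  rcases hν with hgt | hlt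
  · have : (1 : ℝ) < ν := by exact_mod_cast hgt
    exact integral_one_div_of_pos (by linarith) (by linarith)
  · have : (ν : ℝ) < 0 := by exact_mod_cast hlt
    exact integral_one_div_of_neg (by linarith) (by linarith)

/-- **The weight-one island at every rational level, UNCONDITIONAL**: for every rational `ν` with `ν > 1` or
`ν < 0`, Conjecture 1 in kernel form on the sector of all box generators of dimension `≤ 1` at level `ν`,
`[□¹, x^a/(ν − x)^m]` and the constants `[pt, 1/(ν − 1)^m]` — in particular (`ν = −1`) on the ALTERNATING line
sector `[□¹, x^a/(1 + x)^m]` (normal-form value `log 2`). The rigidity hypothesis of `padeBoxKernelGen 1 ν`,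
ℚ-independence of `1/(ν − 1)` and `log (ν/(ν−1))`, is Baker's theorem with one logarithm (the landed
`eq_zero_of_add_mul_log_eq_zero`, from the tree's `baker_holds`). [cite: KontsevichZagier2001, §1.2]
[cite: Baker1975, Theorem 2.1] -/
theorem padeBoxKernelGen_one_rat (ν : ℚ) (hν : 1 < ν ∨ ν < 0) :
    ∀ c ∈ AddSubgroup.closure
      {c | ∃ (j : ℕ) (r : IntegralRep j) (a : Fin j → ℕ) (m : ℕ), j ≤ 1 ∧ r.domain = cube j ∧
          EqOn r.integrand (fun p => (∏ l, p l ^ a l) / ((ν : ℝ) - ∏ l, p l) ^ m) (cube j) ∧ c = KZ.of r},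
      KZ.eval c = 0 → c ∈ KZ.relations := by
  refine padeBoxKernelGen 1 ν hν fun β hβ => ?_
  have hν1 : (ν : ℝ) - 1 ≠ 0 := nu_sub_one_ne hν
  have hν1q : ν - 1 ≠ 0 := by
    rcases hν with h | h
    · exact sub_ne_zero.2 h.ne'
    · intro h0; linarith [h0]
  -- `Σ_{i<2} βᵢ Lᵢ = β₀/(ν − 1) + β₁ log (ν/(ν−1))`
  rw [Finset.sum_range_succ, Finset.sum_range_one] at hβ
  have hL0 : (∫ p in cube 0, 1 / ((ν : ℝ) - ∏ l, p l)) = 1 / ((ν : ℝ) - 1) := by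
    have hcube : cube 0 = (univ : Set (Fin 0 → ℝ)) := eq_univ_of_forall fun x i => i.elim0
    rw [hcube, setIntegral_univ, Measure.volume_pi_eq_dirac (default : Fin 0 → ℝ), integral_dirac]
    simp
  have hL1 : (∫ p in cube 1, 1 / ((ν : ℝ) - ∏ l, p l)) = Real.log (((ν / (ν - 1) : ℚ)) : ℝ) := by
    rw [← integral_cube_one_level hν]
    refine setIntegral_congr_fun measurableSet_cube fun p _ => ?_
    simp
  rw [hL0, hL1] at hβ
  -- the rational `r = ν/(ν − 1)` is positive and `≠ 1`
  have hr : 0 < ν / (ν - 1) := by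
    rcases hν with h | h
    · exact div_pos (by linarith) (by linarith)
    · exact div_pos_of_neg_of_neg h (by linarith)
  have hr1 : ν / (ν - 1) ≠ 1 := by
    intro h1
    rw [div_eq_one_iff_eq hν1q] at h1
    linarith
  have h := eq_zero_of_add_mul_log_eq_zero hr hr1 (a := β 0) (b := β 1 * (ν - 1)) (by
    have := congrArg (fun t => ((ν : ℝ) - 1) * t) hβ
    simp only [mul_zero] at this
    push_cast at this ⊢
    field_simp at this
    linear_combination this)
  intro i hi
  have hi' : i = 0 ∨ i = 1 := by
    have := Finset.mem_range.1 hi; omega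
  rcases hi' with rfl | rfl
  · exact h.1
  · exact (mul_eq_zero.1 h.2).resolve_right hν1q

end Summit.KontsevichZagierPeriods.HermiteRigidity.ReductionRigidity

end
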